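import Mathlib
import Summits.NavierStokesRegularity.NavierStokesRegularity.Theorems.EulerZoomLiouvillePowerGaugeEulerLiouvilleSelfSimilarOffRate
import Summits.NavierStokesRegularity.NavierStokesRegularity.Theorems.EulerZoomLiouvillePowerGaugeEulerLiouvilleSelfSimilarPressureSlaving
import HarnessLib

/-!
# Crux E `PowerGaugeEulerLiouville` (stmt-NavierStokesRegularity-19832): RATE RIGIDITY needs the VELOCITY clause only
# (lane «pressure slaving» ∘ ns-ezl-w4 g2's rate rigidity; LEAD ns-typeII-p2 g11 12:00:17Z (d) / v55; width seat ns-ezl-w3 g2)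

Route `EulerZoomLiouville` (NavierStokesRegularity), crux E.  First consumer of pressure slaving: ns-ezl-w4 g2's RATE RIGIDITY
`OffRate.selfSimilar_ae_eq_zero_of_rate_ne` (an exactly self-similar member of Seregin's `ρ`-class collapses at the class rate `1/(2+ρ)` or is trivial)
carries the pressure clause `∀ τ < 0, p τ = selfSimilarCollapsePressure g 0 P τ`.  By `PressureSlaving.inClass_selfSimilarPressure` the class pressure of a member
with self-similar VELOCITY is a.e. the ansatz of some profile `Q`, and `(u, selfSimilarCollapsePressure g 0 Q, H)` is again in the class with the same constant —
so the pressure clause can be dropped: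

* `OffRate.selfSimilar_ae_eq_zero_of_rate_ne_velocity` — crux hypotheses (`0 < ρ ≤ ½`) + `u τ = selfSimilarCollapse g 0 W τ` for `τ < 0` with `g ≠ 1/(2+ρ)`
  ⇒ `u = 0` a.e. on the slab.  (The LEAD's v55 stratum `IsOffRateSelfSimilar` becomes velocity-only.)

WHAT THIS IS NOT: not NS regularity, not the crux E — a stratum of the crux CLASS 19832 on the MODEL lattice with one hypothesis fewer; `--supports` stmt-19832.
[folklore; cf. BronziShvydkoy2015 Thm 1.1; ChaeShvydkoy2013 §1]
-/

noncomputable section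

-- flat `Theorems/<Route><Decl>…` files of one crux share the namespace of the crux (tree convention: `Summit.<S>.<S>.…`)
set_option linter.dupNamespace false

open MeasureTheory Set Filter Topology Metric Function TopologicalSpace
open scoped ENNReal NNReal

namespace Summit.NavierStokesRegularity.NavierStokesRegularity.Theorems.PowerGaugeEulerLiouville

open Literature.Analysis Literature.Analysis.FunctionSpaces Literature.Analysis.FluidPDE

namespace OffRate

/-- **RATE RIGIDITY, VELOCITY CLAUSE ONLY.**  Crux hypotheses verbatim (`0 < ρ ≤ ½`, weak class) + the VELOCITY is exactly self-similar about the origin at a rate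
`g ≠ 1/(2+ρ)`, `u τ = selfSimilarCollapse g 0 W τ` for `τ < 0` — NO hypothesis on the pressure — ⇒ `u = 0` a.e. on `(−∞,0) × ℝ³`
(`PressureSlaving.inClass_selfSimilarPressure` supplies an in-class ansatz pressure, then ns-ezl-w4 g2's `OffRate.selfSimilar_ae_eq_zero_of_rate_ne`).
[folklore; cf. BronziShvydkoy2015 Thm 1.1] -/
theorem selfSimilar_ae_eq_zero_of_rate_ne_velocity {ρ g : ℝ} (hρ : 0 < ρ) (hρh : ρ ≤ 1 / 2)
    {u : ℝ → EuclideanSpace ℝ (Fin 3) → EuclideanSpace ℝ (Fin 3)} {p : ℝ → EuclideanSpace ℝ (Fin 3) → ℝ}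
    {H : ℝ → EuclideanSpace ℝ (Fin 3) → EuclideanSpace ℝ (Fin 3) →L[ℝ] EuclideanSpace ℝ (Fin 3)} {c : ℝ≥0}
    {W : EuclideanSpace ℝ (Fin 3) → EuclideanSpace ℝ (Fin 3)}
    (hsw : IsSuitableWeakSolutionOn (slab (EuclideanSpace ℝ (Fin 3)) (Iio 0) isOpen_Iio) 0 0 u p)
    (hH : HasWeakSpatialGradientOn (slab (EuclideanSpace ℝ (Fin 3)) (Iio 0) isOpen_Iio) u H)
    (hgauge : ∀ a : ℝ, 0 < a →
      ENNReal.ofReal (a ^ (2 * ρ)) * cknA a (0 : ℝ × EuclideanSpace ℝ (Fin 3)) u +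
          ENNReal.ofReal (a ^ ρ) * cknE a (0 : ℝ × EuclideanSpace ℝ (Fin 3)) H +
        ENNReal.ofReal (a ^ (2 * ρ)) * cknD a (0 : ℝ × EuclideanSpace ℝ (Fin 3)) p ≤ (c : ℝ≥0∞))
    (hg : g ≠ 1 / (2 + ρ))
    (hu : ∀ τ : ℝ, τ < 0 → u τ = selfSimilarCollapse g 0 W τ) :
    uncurry u =ᵐ[volume.restrict (Iio (0 : ℝ) ×ˢ (univ : Set (EuclideanSpace ℝ (Fin 3))))] 0 := by
  obtain ⟨Q, -, -, hsw', -, hgauge'⟩ :=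
    PressureSlaving.inClass_selfSimilarPressure (g := g) (by linarith) ⟨hsw, hH, hgauge⟩ hu
  exact selfSimilar_ae_eq_zero_of_rate_ne hρ hρh hsw' hH hgauge' hg hu fun τ _ => rfl

end OffRate

end Summit.NavierStokesRegularity.NavierStokesRegularity.Theorems.PowerGaugeEulerLiouville

end
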